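import Literature.AnabelianGeometry.EtaleTheta.Discharge.Sec1Thm16iiGaloisIsoOfThm16i
import Literature.AnabelianGeometry.AbsoluteAnabelian.AbsAnabUnitsTransportUnique
import HarnessLib

/-!
# [EtTh] Thm. 1.6 (ii), junction bookkeeping: the [AbsAnab] Prop. 1.2.1 (vii) transport `ψ : ℚ̄_p^× →̃ ℚ̄_p^×` is UNIQUE
# (ℚ̄_p-currency form of abc-iut-L4's `Prop121vii.unitsTransport_unique`), so the cyclotomic-rigidity junction `hΘι` is ONE statement

S. Mochizuki, *The étale theta function …*, Publ. RIMS **45** (2009), §1, Thm. 1.6 (ii) p. 24 [cite: MochizukiEtTh2009, Thm 1.6 (ii) p.24];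
[AbsAnab] Prop. 1.2.1 (vi)/(vii): "THE morphism induced by `α`". Layer L2 of the abc-iut cell, seat abc-iut-L2-t1 (gen 12; sequel of
abc-iut-L2-lead R1221 «T16II-HV»). PROOF-ONLY (no `def`, no instance, no `Prop` fact) over FILE 2 (`Sec1Thm16iiHVOfUnitsTransport`: the
ℚ̄_p-dictionary `algEquivAlgebraicClosure_smul`, `isUniformizer_iff_valuation_isUniformizer`, `exists_psi_of_unitsTransport`) and abc-iut-L6-t13's
`Prop121vii.unitsTransport_unique` (two `α`-equivariant uniformiser-preserving `ψ̄` coincide) — BY NAME.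

RESULTS (cores `Cα`, `Cβ`; `αG : G_{K̈α} ≃ₜ* G_{K̈β}` inside `G_{ℚ_p}` induced by `γ` on `Π^tp_{Ÿα}`, hypothesis `hαG`):
* `KummerCore.isAlphaEquivariant_of_aug` — a `γ`-equivariant `ψ : ℚ̄_p^× →̃ ℚ̄_p^×` becomes, through `algEquivAlgebraicClosure` on both sides, an
  `α`-equivariant `ψ̄ : K̄α^× →̃ K̄β^×` for `α :=` the transported `αG`; `KummerCore.preservesUniformizers_of_norm` — norm-uniformiser preservation
  becomes `PreservesUniformizers ψ̄`;
* **`KummerCore.psi_unique`** — two `γ`-equivariant, uniformiser-preserving `ψ, ψ' : ℚ̄_p^× →̃ ℚ̄_p^×` are EQUAL;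
* **`KummerCore.cyclotomeCompat_forall_iff_exists`** — hence the cyclotomic-rigidity junction in universal form («every such `ψ` is compatible
  with `c` on the cyclotomes», the hypothesis of FILE 3's `thm16ii_toKummerData_of_cyclotomicRigidity`) is EQUIVALENT to its existential form
  («some such `ψ` is compatible») — one well-defined statement about `(γ, c, Cα, Cβ)`: [SemiAnbd] Thm. 6.12 for THE 1.2.1 (vii) transport.
HONEST FRAMING: bookkeeping about the typed interface; nothing of [EtTh] is asserted; no side is taken on [IUTchIII] Cor. 3.12; typed ≠ proved.
-/

noncomputable section

namespace Literature.AnabelianGeometry.EtaleTheta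

open Literature.AnabelianGeometry.SemiGraphs
open Literature.NumberTheory.GaloisRepresentations Literature.AnabelianGeometry.AbsoluteAnabelian
open Literature.AnabelianGeometry.AbsoluteAnabelian.Prop121vii Literature.FieldTheory.Galois Field ValuativeRel
open scoped ValuativeRel

namespace ThetaSetting.KummerCore

variable {p : ℕ} [Fact p.Prime] {Dα Dβ : ThetaSetting p} {γ : Dα.PiTemp ≃ₜ* Dβ.PiTemp}

/-- `α`-equivariance from its value-level form (generic fields, where the Galois action on `K̄^×` elaborates instantly).
[cite: MochizukiAbsAnab2004, Prop 1.2.1 (vi) p.10] -/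
theorem isAlphaEquivariant_of_val {K₁ K₂ : Type} [Field K₁] [Field K₂]
    {α : Field.absoluteGaloisGroup K₁ ≃ₜ* Field.absoluteGaloisGroup K₂} {ψ : (AlgebraicClosure K₁)ˣ ≃* (AlgebraicClosure K₂)ˣ}
    (h : ∀ (σ : Field.absoluteGaloisGroup K₁) (X Y : (AlgebraicClosure K₁)ˣ),
      (Y : AlgebraicClosure K₁) = Field.absoluteGaloisGroup.toAlgEquiv K₁ σ (X : AlgebraicClosure K₁) →
      (ψ Y : AlgebraicClosure K₂) = Field.absoluteGaloisGroup.toAlgEquiv K₂ (α σ) (ψ X : AlgebraicClosure K₂)) :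
    IsAlphaEquivariant α ψ := by
  intro σ X
  apply Units.ext
  rw [Units.coe_smul, Field.absoluteGaloisGroup.smul_def]
  exact h σ X (σ • X) (by rw [Units.coe_smul, Field.absoluteGaloisGroup.smul_def])

/-- **`γ`-equivariance on ℚ̄_p ⇒ `α`-equivariance on the algebraic closures**: for `ψ : ℚ̄_p^× →̃ ℚ̄_p^×` with
`ψ(aug_α y · x) = aug_β(γ y) · ψ x` (`y ∈ Π^tp_{Ÿα}`), the conjugate `ψ̄ := e_β ∘ ψ ∘ e_α⁻¹` is `IsAlphaEquivariant α ψ̄` for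
`α := ẽ_β ∘ αG ∘ ẽ_α⁻¹` (`e := algEquivAlgebraicClosure`, `ẽ := fixingSubgroupEquivAbsoluteGaloisGroup`; `aug_α : Π^tp_{Ÿα} ↠ G_{K̈α}`).
[cite: MochizukiAbsAnab2004, Prop 1.2.1 (vi) p.10] -/
theorem isAlphaEquivariant_of_aug (Cα : Dα.KummerCore)
    (αG : ↥Dα.Kdd.fixingSubgroup ≃ₜ* ↥Dβ.Kdd.fixingSubgroup)
    (hαG : ∀ (y : Dα.PiTemp) (hy : y ∈ Dα.GtpYdd),
      ((αG ⟨Dα.aug y, aug_mem_fixingSubgroup Cα hy⟩ : ↥Dβ.Kdd.fixingSubgroup) : GQp p) = Dβ.aug (γ y))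
    (ψ : (PadicAlgCl p)ˣ ≃* (PadicAlgCl p)ˣ)
    (hψG : ∀ y ∈ Dα.GtpYdd, ∀ x : (PadicAlgCl p)ˣ, ψ (Dα.aug y • x) = Dβ.aug (γ y) • ψ x) :
    IsAlphaEquivariant
      (((fixingSubgroupEquivAbsoluteGaloisGroup Dα.Kdd).symm.trans αG).trans (fixingSubgroupEquivAbsoluteGaloisGroup Dβ.Kdd))
      (((Units.mapEquiv (algEquivAlgebraicClosure Dα.Kdd).symm.toMulEquiv).trans ψ).trans
        (Units.mapEquiv (algEquivAlgebraicClosure Dβ.Kdd).toMulEquiv)) := by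
  refine isAlphaEquivariant_of_val fun σ X Y hY => ?_
  obtain ⟨y, hy, hyσ⟩ := exists_mem_GtpYdd_aug_eq Cα ((fixingSubgroupEquivAbsoluteGaloisGroup Dα.Kdd).symm σ)
  have hσ' : (⟨Dα.aug y, aug_mem_fixingSubgroup Cα hy⟩ : ↥Dα.Kdd.fixingSubgroup) =
      (fixingSubgroupEquivAbsoluteGaloisGroup Dα.Kdd).symm σ := Subtype.ext hyσ
  have hσ : (fixingSubgroupEquivAbsoluteGaloisGroup Dα.Kdd) ⟨Dα.aug y, aug_mem_fixingSubgroup Cα hy⟩ = σ := by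
    rw [hσ']
    exact (fixingSubgroupEquivAbsoluteGaloisGroup Dα.Kdd).apply_symm_apply σ
  -- `e_α⁻¹ Y = aug_α(y) · e_α⁻¹ X` in `ℚ̄_p^×`
  have hL : Units.mapEquiv (algEquivAlgebraicClosure Dα.Kdd).symm.toMulEquiv Y =
      Dα.aug y • Units.mapEquiv (algEquivAlgebraicClosure Dα.Kdd).symm.toMulEquiv X := by
    apply Units.ext
    rw [Units.coe_mapEquiv, hY, ← hσ]
    change (algEquivAlgebraicClosure Dα.Kdd).symm
        (Field.absoluteGaloisGroup.toAlgEquiv (↥Dα.Kdd)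
          (fixingSubgroupEquivAbsoluteGaloisGroup Dα.Kdd ⟨Dα.aug y, aug_mem_fixingSubgroup Cα hy⟩) (X : AlgebraicClosure ↥Dα.Kdd)) =
      ((⟨Dα.aug y, aug_mem_fixingSubgroup Cα hy⟩ : ↥Dα.Kdd.fixingSubgroup) : GQp p) •
        (algEquivAlgebraicClosure Dα.Kdd).symm (X : AlgebraicClosure ↥Dα.Kdd)
    exact algEquivAlgebraicClosure_symm_toAlgEquiv Dα.Kdd _ _
  simp only [MulEquiv.trans_apply, Units.coe_mapEquiv]
  rw [hL, hψG y hy, ContinuousMulEquiv.trans_apply, ContinuousMulEquiv.trans_apply, ← hσ', ← hαG y hy]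
  exact algEquivAlgebraicClosure_smul Dβ.Kdd _ _

/-- **Norm-uniformiser preservation on ℚ̄_p ⇒ `PreservesUniformizers` for the conjugate `ψ̄ := e_β ∘ ψ ∘ e_α⁻¹`.**
[cite: MochizukiAbsAnab2004, Prop 1.2.1 (iv) p.10] -/
theorem preservesUniformizers_of_norm (Cα : Dα.KummerCore) (Cβ : Dβ.KummerCore) (ψ : (PadicAlgCl p)ˣ ≃* (PadicAlgCl p)ˣ)
    (hψϖ : ∀ ϖ : (↥Dα.Kdd)ˣ, IsUniformizer Dα ϖ → ∃ ϖ' : (↥Dβ.Kdd)ˣ, IsUniformizer Dβ ϖ' ∧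
      (ψ (Units.map (algebraMap (↥Dα.Kdd) (PadicAlgCl p) : ↥Dα.Kdd →* PadicAlgCl p) ϖ) : PadicAlgCl p) =
        ((ϖ' : ↥Dβ.Kdd) : PadicAlgCl p)) :
    letI := PadicAlgCl.subfieldValuativeRel Dα.Kdd
    letI := PadicAlgCl.subfieldValuativeRel Dβ.Kdd
    haveI : FiniteDimensional ℚ_[p] Dα.Kdd := Cα.finiteDimensional_Kdd
    haveI : FiniteDimensional ℚ_[p] Dβ.Kdd := Cβ.finiteDimensional_Kdd
    haveI := PadicAlgCl.isNonarchimedeanLocalField_subfield Dα.Kdd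
    haveI := PadicAlgCl.isNonarchimedeanLocalField_subfield Dβ.Kdd
    PreservesUniformizers (((Units.mapEquiv (algEquivAlgebraicClosure Dα.Kdd).symm.toMulEquiv).trans ψ).trans
      (Units.mapEquiv (algEquivAlgebraicClosure Dβ.Kdd).toMulEquiv)) := by
  haveI : FiniteDimensional ℚ_[p] Dα.Kdd := Cα.finiteDimensional_Kdd
  haveI : FiniteDimensional ℚ_[p] Dβ.Kdd := Cβ.finiteDimensional_Kdd
  letI := PadicAlgCl.subfieldValuativeRel Dα.Kdd
  letI := PadicAlgCl.subfieldValuativeRel Dβ.Kdd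
  haveI := PadicAlgCl.isNonarchimedeanLocalField_subfield Dα.Kdd
  haveI := PadicAlgCl.isNonarchimedeanLocalField_subfield Dβ.Kdd
  intro π₁ hπ₁
  obtain ⟨ϖ', hϖ', hψϖ'⟩ := hψϖ π₁ ((isUniformizer_iff_valuation_isUniformizer Dα π₁).mpr hπ₁)
  refine ⟨ϖ', (isUniformizer_iff_valuation_isUniformizer Dβ ϖ').mp hϖ', ?_⟩
  apply Units.ext
  have h1 : Units.mapEquiv (algEquivAlgebraicClosure Dα.Kdd).symm.toMulEquiv
      (Units.map (algebraMap (↥Dα.Kdd) (AlgebraicClosure ↥Dα.Kdd) : ↥Dα.Kdd →* AlgebraicClosure ↥Dα.Kdd) π₁) =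
      Units.map (algebraMap (↥Dα.Kdd) (PadicAlgCl p) : ↥Dα.Kdd →* PadicAlgCl p) π₁ := by
    apply Units.ext
    rw [Units.coe_mapEquiv, Units.coe_map, Units.coe_map, MonoidHom.coe_coe, MonoidHom.coe_coe]
    exact (algEquivAlgebraicClosure Dα.Kdd).symm.commutes _
  rw [MulEquiv.trans_apply, MulEquiv.trans_apply, h1, Units.coe_mapEquiv, hψϖ', Units.coe_map, MonoidHom.coe_coe]
  exact (algEquivAlgebraicClosure Dβ.Kdd).commutes _

/-- **The [AbsAnab] 1.2.1 (vii) transport on ℚ̄_p is UNIQUE**: two `γ`-equivariant, norm-uniformiser-preserving `ψ, ψ' : ℚ̄_p^× →̃ ℚ̄_p^×` are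
equal (abc-iut-L6-t13's `Prop121vii.unitsTransport_unique` through the dictionary of FILE 2). [cite: MochizukiAbsAnab2004, Prop 1.2.1 (vii) p.11] -/
theorem psi_unique (Cα : Dα.KummerCore) (Cβ : Dβ.KummerCore)
    (αG : ↥Dα.Kdd.fixingSubgroup ≃ₜ* ↥Dβ.Kdd.fixingSubgroup)
    (hαG : ∀ (y : Dα.PiTemp) (hy : y ∈ Dα.GtpYdd),
      ((αG ⟨Dα.aug y, aug_mem_fixingSubgroup Cα hy⟩ : ↥Dβ.Kdd.fixingSubgroup) : GQp p) = Dβ.aug (γ y))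
    {ψ ψ' : (PadicAlgCl p)ˣ ≃* (PadicAlgCl p)ˣ}
    (hψG : ∀ y ∈ Dα.GtpYdd, ∀ x : (PadicAlgCl p)ˣ, ψ (Dα.aug y • x) = Dβ.aug (γ y) • ψ x)
    (hψ'G : ∀ y ∈ Dα.GtpYdd, ∀ x : (PadicAlgCl p)ˣ, ψ' (Dα.aug y • x) = Dβ.aug (γ y) • ψ' x)
    (hψϖ : ∀ ϖ : (↥Dα.Kdd)ˣ, IsUniformizer Dα ϖ → ∃ ϖ' : (↥Dβ.Kdd)ˣ, IsUniformizer Dβ ϖ' ∧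
      (ψ (Units.map (algebraMap (↥Dα.Kdd) (PadicAlgCl p) : ↥Dα.Kdd →* PadicAlgCl p) ϖ) : PadicAlgCl p) =
        ((ϖ' : ↥Dβ.Kdd) : PadicAlgCl p))
    (hψ'ϖ : ∀ ϖ : (↥Dα.Kdd)ˣ, IsUniformizer Dα ϖ → ∃ ϖ' : (↥Dβ.Kdd)ˣ, IsUniformizer Dβ ϖ' ∧
      (ψ' (Units.map (algebraMap (↥Dα.Kdd) (PadicAlgCl p) : ↥Dα.Kdd →* PadicAlgCl p) ϖ) : PadicAlgCl p) =
        ((ϖ' : ↥Dβ.Kdd) : PadicAlgCl p)) :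
    ψ' = ψ := by
  haveI : FiniteDimensional ℚ_[p] Dα.Kdd := Cα.finiteDimensional_Kdd
  haveI : FiniteDimensional ℚ_[p] Dβ.Kdd := Cβ.finiteDimensional_Kdd
  letI := PadicAlgCl.subfieldValuativeRel Dα.Kdd
  letI := PadicAlgCl.subfieldValuativeRel Dβ.Kdd
  haveI := PadicAlgCl.isNonarchimedeanLocalField_subfield Dα.Kdd
  haveI := PadicAlgCl.isNonarchimedeanLocalField_subfield Dβ.Kdd
  have key := unitsTransport_unique (isAlphaEquivariant_of_aug (γ := γ) Cα αG hαG ψ hψG)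
    (isAlphaEquivariant_of_aug (γ := γ) Cα αG hαG ψ' hψ'G)
    (preservesUniformizers_of_norm Cα Cβ ψ hψϖ) (preservesUniformizers_of_norm Cα Cβ ψ' hψ'ϖ)
  apply MulEquiv.ext
  intro x
  have hx := MulEquiv.congr_fun key (Units.mapEquiv (algEquivAlgebraicClosure Dα.Kdd).toMulEquiv x)
  have e1 : ∀ χ : (PadicAlgCl p)ˣ ≃* (PadicAlgCl p)ˣ,
      (((Units.mapEquiv (algEquivAlgebraicClosure Dα.Kdd).symm.toMulEquiv).trans χ).trans
        (Units.mapEquiv (algEquivAlgebraicClosure Dβ.Kdd).toMulEquiv))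
        (Units.mapEquiv (algEquivAlgebraicClosure Dα.Kdd).toMulEquiv x) =
      Units.mapEquiv (algEquivAlgebraicClosure Dβ.Kdd).toMulEquiv (χ x) := by
    intro χ
    rw [MulEquiv.trans_apply, MulEquiv.trans_apply]
    congr 2
    apply Units.ext
    rw [Units.coe_mapEquiv, Units.coe_mapEquiv]
    exact (algEquivAlgebraicClosure Dα.Kdd).symm_apply_apply _
  rw [e1, e1] at hx
  exact (Units.mapEquiv (algEquivAlgebraicClosure Dβ.Kdd).toMulEquiv).injective hx

/-- **The cyclotomic-rigidity junction is ONE statement**: given the existence of the [AbsAnab] 1.2.1 (vii) transport (FILE 2's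
`exists_psi_of_unitsTransport`) and its uniqueness (`psi_unique`), «EVERY `γ`-equivariant, `‖·‖=1`- and uniformiser-preserving `ψ` is
compatible with `c` on the cyclotomes» ⟺ «SOME such `ψ` is» — the universal hypothesis `hΘι` of FILE 3's
`thm16ii_toKummerData_of_cyclotomicRigidity` is [SemiAnbd] Thm. 6.12 for THE transport. [cite: MochizukiEtTh2009, Thm 1.6 (ii) p.24] -/
theorem cyclotomeCompat_forall_iff_exists (c : ThetaCompanion γ) (Cα : Dα.KummerCore) (Cβ : Dβ.KummerCore)
    (αG : ↥Dα.Kdd.fixingSubgroup ≃ₜ* ↥Dβ.Kdd.fixingSubgroup)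
    (hαG : ∀ (y : Dα.PiTemp) (hy : y ∈ Dα.GtpYdd),
      ((αG ⟨Dα.aug y, aug_mem_fixingSubgroup Cα hy⟩ : ↥Dβ.Kdd.fixingSubgroup) : GQp p) = Dβ.aug (γ y)) :
    (∀ ψ : (PadicAlgCl p)ˣ ≃* (PadicAlgCl p)ˣ,
      (∀ y ∈ Dα.GtpYdd, ∀ x : (PadicAlgCl p)ˣ, ψ (Dα.aug y • x) = Dβ.aug (γ y) • ψ x) →
      (∀ x : (PadicAlgCl p)ˣ, ‖(x : PadicAlgCl p)‖ = 1 ↔ ‖(ψ x : PadicAlgCl p)‖ = 1) →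
      (∀ ϖ : (↥Dα.Kdd)ˣ, IsUniformizer Dα ϖ → ∃ ϖ' : (↥Dβ.Kdd)ˣ, IsUniformizer Dβ ϖ' ∧
        (ψ (Units.map (algebraMap (↥Dα.Kdd) (PadicAlgCl p) : ↥Dα.Kdd →* PadicAlgCl p) ϖ) : PadicAlgCl p) =
          ((ϖ' : ↥Dβ.Kdd) : PadicAlgCl p)) →
      ∀ ζ : cyclotome (PadicAlgCl p)ˣ,
        c.thetaIso (Cα.coeffHom ζ : Dα.GtpTheta) =
          (Cβ.coeffHom (cyclotome.map (ψ : (PadicAlgCl p)ˣ →* (PadicAlgCl p)ˣ) ζ) : Dβ.GtpTheta)) ↔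
    (∃ ψ : (PadicAlgCl p)ˣ ≃* (PadicAlgCl p)ˣ,
      (∀ y ∈ Dα.GtpYdd, ∀ x : (PadicAlgCl p)ˣ, ψ (Dα.aug y • x) = Dβ.aug (γ y) • ψ x) ∧
      (∀ x : (PadicAlgCl p)ˣ, ‖(x : PadicAlgCl p)‖ = 1 ↔ ‖(ψ x : PadicAlgCl p)‖ = 1) ∧
      (∀ ϖ : (↥Dα.Kdd)ˣ, IsUniformizer Dα ϖ → ∃ ϖ' : (↥Dβ.Kdd)ˣ, IsUniformizer Dβ ϖ' ∧
        (ψ (Units.map (algebraMap (↥Dα.Kdd) (PadicAlgCl p) : ↥Dα.Kdd →* PadicAlgCl p) ϖ) : PadicAlgCl p) =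
          ((ϖ' : ↥Dβ.Kdd) : PadicAlgCl p)) ∧
      ∀ ζ : cyclotome (PadicAlgCl p)ˣ,
        c.thetaIso (Cα.coeffHom ζ : Dα.GtpTheta) =
          (Cβ.coeffHom (cyclotome.map (ψ : (PadicAlgCl p)ˣ →* (PadicAlgCl p)ˣ) ζ) : Dβ.GtpTheta)) := by
  obtain ⟨ψ₀, hψ₀G, hψ₀u, hψ₀ϖ⟩ := exists_psi_of_unitsTransport (γ := γ) Cα Cβ αG hαG
  constructor
  · intro hall
    exact ⟨ψ₀, hψ₀G, hψ₀u, hψ₀ϖ, hall ψ₀ hψ₀G hψ₀u hψ₀ϖ⟩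
  · rintro ⟨ψ, hψG, -, hψϖ, hψc⟩ ψ' hψ'G - hψ'ϖ
    rw [psi_unique Cα Cβ αG hαG hψG hψ'G hψϖ hψ'ϖ]
    exact hψc

end ThetaSetting.KummerCore

end Literature.AnabelianGeometry.EtaleTheta

end
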